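import Summits.BirchSwinnertonDyer.BirchSwinnertonDyer.Theorems.ResidualThetaTransportAtTwoResidualThetaMainConjectureAtTwoLayerMuReading
import HarnessLib

/-!
# Route `ResidualThetaTransportAtTwo`, crux Kμ⁺ `SignedMuVanishingAtTwoPlus` (stmt-BirchSwinnertonDyer-20689):
# ONE even Mazur–Tate layer with a `2`-adic unit coefficient certifies `μ(L♭) = 0` AND `λ(L♭)` AT ONCE —
# `λ(L♭) = λ_n(θ_n(f)) − (2ⁿ − 1)/3` with NO a-priori bound on `λ` (self-certifying layer reading)

Cell `bsd-wall`, width seat `bsd-wall-rtt-p4-w2` on the lead line `birth` (v4). THEOREMS ONLY (no `def`, no named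
fact, no `sorry`); route-independent helper `--supports` the crux (its analytic stubs are read on Mazur–Tate
layers; the same layer reading feeds the sibling cruxes Kλ⁺ 20787 / Kan⁺ 20688, whose currency is `λ`); nothing
about any curve is asserted and BSD is not proved by this.

The sibling crux's reading (seat rtt-p2, `…LayerMuReading` / `…LayerReading`) proves, for a weight-2 form `f`
with a Pollack pair `(L♯, L♭)` at `2` and even `n`: `μ_n(θ_n(f)) ≥ μ(L♭)` always, and `μ_n = μ(L♭)`,
`λ_n(θ_n(f)) = (2ⁿ − 1)/3 + λ(L♭)` PROVIDED `n ≥ 2λ(L♭) + 2` — a threshold that involves the unknown `λ(L♭)`.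
This file removes the threshold from the CERTIFICATE direction:

* `lam_add_lt_and_layerLambda_eq_of_supNorm_mazurTateElement_two_eq_one` — if at SOME even layer `n` the
  Mazur–Tate element `θ_n(f)` has a `2`-adic unit coefficient (`max_j |θ_n(f)_j|₂ = 1`), then
  `(2ⁿ − 1)/3 + λ(L♭) < 2ⁿ` and **`λ_n(θ_n(f)) = (2ⁿ − 1)/3 + λ(L♭)`** (Pollack–Weston's layer `λ` = the index
  of the first coefficient of maximal norm). Proof: `θ_n = 2^{μ(L♭)} P_n` with `P_n ∈ ℤ₂[X]`,
  `P̄_n = u X^{d_n} L̄₀ mod X^{2ⁿ}` (`d_n = (2ⁿ−1)/3`, `L♭ = 2^{μ} L₀`, `ord_X L̄₀ = λ(L♭)`); a unit coefficient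
  forces `μ(L♭) = 0` (rtt-p2) and sits at an index `k < 2ⁿ` with `P̄_n`'s `k`-th coefficient non-zero, whence
  `d_n ≤ k` and `λ(L♭) ≤ k − d_n`; so the room `d_n + λ(L♭) < 2ⁿ` holds and the first unit index is `d_n + λ(L♭)`.
* `lam_eq_of_supNorm_mazurTateElement_two_eq_one` — the reading `λ(L♭) = λ_n(θ_n(f)) − (2ⁿ − 1)/3`;
  `mu_eq_zero_and_lam_eq_of_supNorm_…` — both invariants from the one layer. So an ENGINE row
  `(μ_n, λ_n) = (0, λ_n)` at ONE even layer is a certificate of `(μ(L♭), λ(L♭)) = (0, λ_n − (2ⁿ−1)/3)` — e.g.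
  D-rtt-1's `(μ_6, λ_6)` certifies `λ(L♭) = λ_6 − 21` (and predicts `λ_8 = λ_6 + 64`, as observed on 45/45
  curves); for Kμ⁺ this turns the refuter door's threshold `n ≥ 2λ(L♭) + 2` (p579652) into a checkable one
  once a neighbouring class certifies `λ`, and for Kλ⁺/Kan⁺ it reads `λ(G) = λ(L♭)` off a finite layer.

References: R. Pollack, Duke Math. J. 118 (2003) Prop. 6.18 [Pollack2003]; R. Pollack, T. Weston, Duke Math. J.
156 (2011) §3.1, §4 [PollackWeston2011MT]; M. Kurihara, Invent. Math. 149 (2002) [Kurihara2002].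
-/

set_option linter.dupNamespace false
set_option autoImplicit false

noncomputable section

open scoped Classical MatrixGroups ModularForm

open Polynomial Literature.NumberTheory.EllipticCurves Literature.NumberTheory.IwasawaTheory
  Summit.BirchSwinnertonDyer.Rank1Residual.X1.MuLambda Summit.BirchSwinnertonDyer.Rank1Residual.Supersingular
  Summit.BirchSwinnertonDyer.BirchSwinnertonDyer.Theorems.ResidualThetaLayer

namespace Summit.BirchSwinnertonDyer.BirchSwinnertonDyer.Theorems.SignedMuAtTwo

variable {N : ℕ} (f : CuspForm (CongruenceSubgroup.Gamma0 N) 2) {Lplus Lminus : IwasawaAlgebra 2}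

/-- **One even layer with a unit coefficient certifies the room `d_n + λ(L♭) < 2ⁿ` AND the exact layer `λ`**:
if `max_j |θ_n(f)_j|₂ = 1` for some even `n`, then `(2ⁿ − 1)/3 + λ(L♭) < 2ⁿ` and
`λ_n(θ_n(f)) = (2ⁿ − 1)/3 + λ(L♭)` — with NO a-priori bound on `λ(L♭)`.
[cite: Pollack2003, Prop. 6.18] [cite: PollackWeston2011MT, §3.1 and §4] -/
theorem lam_add_lt_and_layerLambda_eq_of_supNorm_mazurTateElement_two_eq_one
    (hPP : IsPollackPair f 2 Lplus Lminus) {n : ℕ} (heven : Even n)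
    (h1 : ((mazurTateElement f 2 n).map (algebraMap ℚ (PadicAlgCl 2))).supNorm = 1) :
    (2 ^ n - 1) / 3 + lam Lminus < 2 ^ n ∧
      layerLambda ((mazurTateElement f 2 n).map (algebraMap ℚ (PadicAlgCl 2))) = (2 ^ n - 1) / 3 + lam Lminus := by
  set φ : ℤ_[2] →+* PadicAlgCl 2 := (algebraMap ℚ_[2] (PadicAlgCl 2)).comp (algebraMap ℤ_[2] ℚ_[2])
    with hφdef
  have hφ : ∀ x, ‖φ x‖ = ‖x‖ := norm_algebraMap_padicInt_padicAlgCl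
  have hLm : Lminus ≠ 0 := hPP.2.1
  -- `μ(L♭) = 0`, so `θ_n = P.map φ` with the coefficient law of `P`
  have hμ : mu Lminus = 0 := mu_eq_zero_of_supNorm_mazurTateElement_two_eq_one f hPP heven h1
  obtain ⟨P, hθP, hcoeff⟩ := exists_integralModel_mazurTateElement_two f hPP heven
  rw [hμ, pow_zero, C_1, one_mul] at hθP
  set d : ℕ := (2 ^ n - 1) / 3 with hd
  -- a coefficient of norm `1`, at an index `k < 2ⁿ`
  obtain ⟨k, hk⟩ := ((mazurTateElement f 2 n).map (algebraMap ℚ (PadicAlgCl 2))).exists_eq_supNorm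
  rw [h1] at hk
  have hk_lt : k < 2 ^ n := by
    by_contra hge
    have h0 : (mazurTateElement f 2 n).coeff k = 0 :=
      coeff_eq_zero_of_natDegree_lt (lt_of_lt_of_le (natDegree_mazurTateElement_lt f 2 n) (not_lt.mp hge))
    rw [coeff_map, h0, map_zero, norm_zero] at hk
    exact one_ne_zero hk
  have hPk : ‖P.coeff k‖ = 1 := by
    rw [hθP, coeff_map, hφ] at hk
    exact hk.symm
  have hunit : PadicInt.toZMod (P.coeff k) ≠ 0 := by
    intro h0
    rw [← RingHom.mem_ker, PadicInt.ker_toZMod, IsLocalRing.mem_maximalIdeal, PadicInt.mem_nonunits] at h0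
    exact absurd hPk h0.ne
  -- hence `d ≤ k` and the `(k - d)`-th coefficient of `L̄₀` is non-zero: `λ(L♭) ≤ k - d`
  have hlam := order_map_toZMod_pfree_eq_lam hLm
  rw [hcoeff k hk_lt] at hunit
  have hdk : d ≤ k := by
    by_contra h
    rw [if_neg h, mul_zero] at hunit
    exact hunit rfl
  rw [if_pos hdk] at hunit
  have hcoef_ne : PowerSeries.coeff (k - d) (PowerSeries.map (PadicInt.toZMod (p := 2)) (pfree Lminus)) ≠ 0 :=
    fun h ↦ hunit (by rw [h, mul_zero])
  have hlam_le : lam Lminus ≤ k - d := by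
    have h := PowerSeries.order_le (k - d) hcoef_ne
    rw [hlam] at h
    exact_mod_cast h
  have hroom : d + lam Lminus < 2 ^ n := by omega
  refine ⟨hroom, ?_⟩
  -- the standard reading below the room
  rw [PowerSeries.order_eq_nat] at hlam
  obtain ⟨hlamne, hlamlt⟩ := hlam
  have hu : ((-1 : ZMod 2) ^ (n / 2 + 1)) ≠ 0 := pow_ne_zero _ (neg_ne_zero.mpr one_ne_zero)
  have hk' : PadicInt.toZMod (P.coeff (d + lam Lminus)) ≠ 0 := by
    rw [hcoeff _ hroom, if_pos (Nat.le_add_right d _), Nat.add_sub_cancel_left]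
    exact mul_ne_zero hu hlamne
  have hlt : ∀ i < d + lam Lminus, PadicInt.toZMod (P.coeff i) = 0 := fun i hi ↦ by
    rw [hcoeff _ (hi.trans hroom)]
    split_ifs with hdi
    · rw [hlamlt (i - d) (by omega), mul_zero]
    · rw [mul_zero]
  rw [hθP]
  exact (layerLambda_map_eq_of_coeff φ hφ hlt hk').1

/-- **`λ(L♭)` READ OFF ONE LAYER**: if some even layer `n` has `max_j |θ_n(f)_j|₂ = 1`, then
`λ(L♭) = λ_n(θ_n(f)) − (2ⁿ − 1)/3`. [cite: PollackWeston2011MT, §3.1 and §4] -/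
theorem lam_eq_of_supNorm_mazurTateElement_two_eq_one (hPP : IsPollackPair f 2 Lplus Lminus) {n : ℕ}
    (heven : Even n) (h1 : ((mazurTateElement f 2 n).map (algebraMap ℚ (PadicAlgCl 2))).supNorm = 1) :
    lam Lminus = layerLambda ((mazurTateElement f 2 n).map (algebraMap ℚ (PadicAlgCl 2))) - (2 ^ n - 1) / 3 := by
  have h := (lam_add_lt_and_layerLambda_eq_of_supNorm_mazurTateElement_two_eq_one f hPP heven h1).2
  omega

/-- **Both invariants from ONE layer**: a `2`-adic unit coefficient of `θ_n(f)` at an even layer `n` certifies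
`μ(L♭) = 0` and `λ(L♭) = λ_n(θ_n(f)) − (2ⁿ − 1)/3` (the per-class reading of the cell's `(μ_n, λ_n)` tables).
[cite: Pollack2003, Prop. 6.18] [cite: PollackWeston2011MT, §3.1 and §4] -/
theorem mu_eq_zero_and_lam_eq_of_supNorm_mazurTateElement_two_eq_one (hPP : IsPollackPair f 2 Lplus Lminus)
    {n : ℕ} (heven : Even n) (h1 : ((mazurTateElement f 2 n).map (algebraMap ℚ (PadicAlgCl 2))).supNorm = 1) :
    mu Lminus = 0 ∧
      lam Lminus = layerLambda ((mazurTateElement f 2 n).map (algebraMap ℚ (PadicAlgCl 2))) - (2 ^ n - 1) / 3 :=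
  ⟨mu_eq_zero_of_supNorm_mazurTateElement_two_eq_one f hPP heven h1,
    lam_eq_of_supNorm_mazurTateElement_two_eq_one f hPP heven h1⟩

/-- **Propagation to higher layers**: once some even layer `n₀` has a unit coefficient, EVERY even layer
`n ≥ n₀` has one and reads the same `λ`: `λ_n(θ_n(f)) = (2ⁿ − 1)/3 + λ(L♭)` (so consecutive even layers differ
by `λ_{n+2} − λ_n = 2ⁿ`, the pattern of the cell's tables). [cite: PollackWeston2011MT, §3.1 and §4] -/
theorem layerLambda_eq_of_le_of_supNorm_mazurTateElement_two_eq_one (hPP : IsPollackPair f 2 Lplus Lminus)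
    {n₀ n : ℕ} (heven₀ : Even n₀) (heven : Even n) (hle : n₀ ≤ n)
    (h1 : ((mazurTateElement f 2 n₀).map (algebraMap ℚ (PadicAlgCl 2))).supNorm = 1) :
    ((mazurTateElement f 2 n).map (algebraMap ℚ (PadicAlgCl 2))).supNorm = 1 ∧
      layerLambda ((mazurTateElement f 2 n).map (algebraMap ℚ (PadicAlgCl 2))) = (2 ^ n - 1) / 3 + lam Lminus := by
  have hμ : mu Lminus = 0 := mu_eq_zero_of_supNorm_mazurTateElement_two_eq_one f hPP heven₀ h1
  have hroom₀ := (lam_add_lt_and_layerLambda_eq_of_supNorm_mazurTateElement_two_eq_one f hPP heven₀ h1).1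
  -- room at layer `n`: `(2ⁿ−1)/3 + λ < 2ⁿ` from the room at `n₀ ≤ n`
  have hpow : 2 ^ n₀ ≤ 2 ^ n := Nat.pow_le_pow_right two_pos hle
  have hroom : (2 ^ n - 1) / 3 + lam Lminus < 2 ^ n := by omega
  -- at layer `n` the integral model has a unit coefficient at `d_n + λ`
  set φ : ℤ_[2] →+* PadicAlgCl 2 := (algebraMap ℚ_[2] (PadicAlgCl 2)).comp (algebraMap ℤ_[2] ℚ_[2])
    with hφdef
  have hφ : ∀ x, ‖φ x‖ = ‖x‖ := norm_algebraMap_padicInt_padicAlgCl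
  have hLm : Lminus ≠ 0 := hPP.2.1
  obtain ⟨P, hθP, hcoeff⟩ := exists_integralModel_mazurTateElement_two f hPP heven
  rw [hμ, pow_zero, C_1, one_mul] at hθP
  have hlam := order_map_toZMod_pfree_eq_lam hLm
  rw [PowerSeries.order_eq_nat] at hlam
  obtain ⟨hlamne, hlamlt⟩ := hlam
  set d : ℕ := (2 ^ n - 1) / 3 with hd
  have hu : ((-1 : ZMod 2) ^ (n / 2 + 1)) ≠ 0 := pow_ne_zero _ (neg_ne_zero.mpr one_ne_zero)
  have hk' : PadicInt.toZMod (P.coeff (d + lam Lminus)) ≠ 0 := by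
    rw [hcoeff _ hroom, if_pos (Nat.le_add_right d _), Nat.add_sub_cancel_left]
    exact mul_ne_zero hu hlamne
  have hlt : ∀ i < d + lam Lminus, PadicInt.toZMod (P.coeff i) = 0 := fun i hi ↦ by
    rw [hcoeff _ (hi.trans hroom)]
    split_ifs with hdi
    · rw [hlamlt (i - d) (by omega), mul_zero]
    · rw [mul_zero]
  have h := layerLambda_map_eq_of_coeff φ hφ hlt hk'
  rw [hθP]
  exact ⟨h.2, h.1⟩

end Summit.BirchSwinnertonDyer.BirchSwinnertonDyer.Theorems.SignedMuAtTwo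

end
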